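import Literature.NumberTheory.Sieve.LogFourierSeparation
import Literature.NumberTheory.Sieve.NumberFieldLargeSieveBilinear
import Literature.NumberTheory.Sieve.NumberFieldVaughanIdentity
import Literature.NumberTheory.Sieve.MitsuiTotallyReal
import HarnessLib

/-!
# The reparametrisation `(𝔟, α) ↔ (α₁, α₂)` of the type II sums (Hinz 1988, §4, pp. 187–188)

Topic `Literature/NumberTheory/Sieve`, sub-namespace `TypeTwoReparam`. Hinz, proof of (4.10):
"for a narrow class `ℭ` fix prime ideals `𝔭₁ ∈ ℭ⁻¹`, `𝔭₂ ∈ ℭ` … `𝔭₁𝔭₂` is a principal ideal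
with a totally positive generator `ρ₀` … `(ρ₀α) = (𝔭₁𝔞)(𝔭₂𝔟) = (α₁)(β)` … we fix a totally
positive generator `α₁` of `𝔭₁𝔞` … `α₂ = ρ₀α/α₁` … `χ(α) = χ(α₁)χ(α₂)χ̄(ρ₀)` … hence
`S₄ = −∑∑ χ̄(ρ₀) ∑'' c₁(α₁) c₂(α₂) χ(α₁α₂)`" (display before (4.20)). This file PROVES the
identity in the smooth setting, for one block `Bl` of ideals `𝔟` (in the application: a dyadic
norm range inside one narrow class) with chosen totally positive generators `gen 𝔟` of `𝔭₁𝔟`: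

  `∑_{𝔟 ∈ Bl} Λ(𝔟) ∑_{α ∈ B, 𝔟 ∣ (α), (α) ≠ 𝔟} Ω(α) χ(α) e_U((α)/𝔟)`
  `  = χ̄(ρ₀) ∑_{α₁ ∈ gen(Bl)} ∑_{α₂ ∈ A₂} c₁(α₁) c₂(α₂) Ω×(α₁, α₂) χ(α₁α₂)`        (`reparam`)

with `Ω(α) = ∏_w k(log σ_w α − log M)` a product weight in logarithmic coordinates,
`Ω×(α₁,α₂) = ∏_w k(log σ_wα₁ + log σ_wα₂ − log σ_wρ₀ − log M)` the cross weight of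
`LogFourierSeparation` (`LogSep.crossWeight`), `c₁(α₁) = Λ((α₁)/𝔭₁)`,
`c₂(α₂) = e_U((α₂)/𝔭₂)·[α₂ ≫ 0, 𝔭₂ ∣ (α₂) ≠ 𝔭₂]`, valid whenever `B` contains the totally
positive support of `Ω` and `A₂` contains all the `α₂ = ρ₀α/gen(𝔟)` that occur (hypotheses
`hBsupp`, `hA₂`), and `ρ₀` is prime to `𝔮` (`Finset.sum_bij_ne_zero` on the supports).

* `quot`, `gen_mul_quot` — `α₂ = ρ₀α/gen 𝔟` and `gen 𝔟 · α₂ = ρ₀ α`;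
* `weightΩ`, `coeff₁`, `coeff₂`, `crossΩ`, `S4block` — the objects;
* `reparam` — the identity; `norm_S4block_eq` — `|S₄-block(χ)| = |∑∑ c₁c₂ Ω× χ(α₁α₂)|`.

## References

* J. Hinz, Acta Arith. 51 (1988), §4, (4.11)–(4.19) and the display before (4.20).
  [cite: Hinz1988, §4 (4.11)–(4.19)]
-/

noncomputable section

open Finset NumberField NumberField.InfinitePlace
  Literature.NumberTheory.Sieve.NumberFieldLS Literature.NumberTheory.Sieve.BoxPrimes
  Literature.NumberTheory.Sieve.NumberFieldVaughan Literature.NumberTheory.Sieve.LogSep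
  Literature.NumberTheory.Sieve.MitsuiPNT Literature.NumberTheory.LFunctions
open scoped Classical ComplexConjugate

namespace Literature.NumberTheory.Sieve.TypeTwoReparam

variable {K : Type*} [Field K] [NumberField K]

local notation "RP" => {w : InfinitePlace K // IsReal w}

/-! ## Divisibility and the quotient `α₂ = ρ₀α/α₁` -/

section Quot

variable {𝔭₁ 𝔭₂ : Ideal (𝓞 K)} {ρ₀ : 𝓞 K}

/-- If `(ρ₀) = 𝔭₁𝔭₂`, `(g) = 𝔭₁𝔟` and `𝔟 ∣ (α)` then `g ∣ ρ₀α`. [folklore] -/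
theorem gen_dvd (hρ : Ideal.span {ρ₀} = 𝔭₁ * 𝔭₂) {𝔟 : Ideal (𝓞 K)} {g : 𝓞 K}
    (hg : Ideal.span {g} = 𝔭₁ * 𝔟) {α : 𝓞 K} (hα : 𝔟 ∣ Ideal.span {α}) : g ∣ ρ₀ * α := by
  rw [← Ideal.span_singleton_le_span_singleton, ← Ideal.span_singleton_mul_span_singleton, hρ, hg,
    ← Ideal.dvd_iff_le]
  obtain ⟨𝔠, h𝔠⟩ := hα
  exact ⟨𝔭₂ * 𝔠, by rw [h𝔠]; ring⟩

/-- `α₂ = ρ₀α/g` when `g ∣ ρ₀α` (junk `0` otherwise). [cite: Hinz1988, §4 (α₂ := ρ₀α/α₁)] -/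
def quot (ρ₀ g α : 𝓞 K) : 𝓞 K := if h : g ∣ ρ₀ * α then h.choose else 0

omit [NumberField K] in
/-- `g · quot = ρ₀ α`. [folklore] -/
theorem gen_mul_quot {g α : 𝓞 K} (h : g ∣ ρ₀ * α) : g * quot ρ₀ g α = ρ₀ * α := by
  rw [quot, dif_pos h]; exact h.choose_spec.symm

/-- If `(ρ₀) = 𝔭₁𝔭₂`, `(α₁) = 𝔭₁𝔟` and `𝔭₂ ∣ (α₂)` then `ρ₀ ∣ α₁α₂`. [folklore] -/
theorem rho_dvd (hρ : Ideal.span {ρ₀} = 𝔭₁ * 𝔭₂) {𝔟 : Ideal (𝓞 K)} {α₁ α₂ : 𝓞 K}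
    (h₁ : Ideal.span {α₁} = 𝔭₁ * 𝔟) (h₂ : 𝔭₂ ∣ Ideal.span {α₂}) : ρ₀ ∣ α₁ * α₂ := by
  rw [← Ideal.span_singleton_le_span_singleton, ← Ideal.span_singleton_mul_span_singleton, hρ, h₁,
    ← Ideal.dvd_iff_le]
  obtain ⟨𝔠, h𝔠⟩ := h₂
  exact ⟨𝔟 * 𝔠, by rw [h𝔠]; ring⟩

end Quot

/-! ## The objects -/

section Objects

variable (K) in
/-- The product weight in logarithmic coordinates, `Ω(α) = ∏_w k(log σ_w α − log M)`.
[cite: Hinz1988, §4 (4.15)] -/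
def weightΩ (k : ℝ → ℂ) (M : ℝ) (α : 𝓞 K) : ℂ := ∏ w : RP, k (Real.log (remb K (α : K) w) - Real.log M)

variable (K) in
/-- The logarithmic coordinates `ℓ(α)_w = log σ_w α`. [folklore] -/
def logv (α : 𝓞 K) (w : RP) : ℝ := Real.log (remb K (α : K) w)

variable (K) in
/-- The cross weight `Ω×(α₁,α₂) = ∏_w k(log σ_wα₁ + log σ_wα₂ − log σ_wρ₀ − log M)`
(`LogSep.crossWeight` with `h_w = k`, `ℓ = log σ`, `s_w = log σ_wρ₀ + log M`).
[cite: Hinz1988, §4 (4.15)] -/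
def crossΩ (k : ℝ → ℂ) (M : ℝ) (ρ₀ : 𝓞 K) (α₁ α₂ : 𝓞 K) : ℂ :=
  crossWeight (fun _ : RP => k) (logv K) (logv K) (fun w => logv K ρ₀ w + Real.log M) α₁ α₂

variable (K) in
/-- `c₁(α₁) = Λ((α₁)/𝔭₁)`. [cite: Hinz1988, §4 (4.19)] -/
def coeff₁ (𝔭₁ : Ideal (𝓞 K)) (α₁ : 𝓞 K) : ℂ := (idealVonMangoldt (cofactor (Ideal.span {α₁}) 𝔭₁) : ℂ)

variable (K) in
/-- `c₂(α₂) = e_U((α₂)/𝔭₂)` if `α₂ ≫ 0`, `𝔭₂ ∣ (α₂)`, `(α₂) ≠ 𝔭₂`; else `0`.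
[cite: Hinz1988, §4 (4.17)] -/
def coeff₂ (𝔭₂ : Ideal (𝓞 K)) (U : ℝ) (α₂ : 𝓞 K) : ℂ :=
  if NumberField.IsTotPos K (α₂ : K) ∧ 𝔭₂ ∣ Ideal.span {α₂} ∧ cofactor (Ideal.span {α₂}) 𝔭₂ ≠ ⊤ then
    (eU K U (cofactor (Ideal.span {α₂}) 𝔭₂) : ℂ) else 0

variable (K) in
/-- The `S₄`-block: `∑_{𝔟 ∈ Bl} Λ(𝔟) ∑_{α ∈ B, 𝔟 ∣ (α), (α) ≠ 𝔟} Ω(α) χ(α) e_U((α)/𝔟)`.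
[cite: Hinz1988, §4 (display before (4.11))] -/
def S4block {𝔮 : Ideal (𝓞 K)} (χ : AddChar (Additive ((𝓞 K ⧸ 𝔮)ˣ)) ℂ) (k : ℝ → ℂ) (M U : ℝ)
    (Bl : Finset (Ideal (𝓞 K))) (B : Finset (𝓞 K)) : ℂ :=
  ∑ 𝔟 ∈ Bl, (idealVonMangoldt 𝔟 : ℂ) *
    ∑ α ∈ B.filter (fun α => 𝔟 ∣ Ideal.span {α} ∧ cofactor (Ideal.span {α}) 𝔟 ≠ ⊤),
      weightΩ K k M α * unitValue χ (Ideal.Quotient.mk 𝔮 α) * (eU K U (cofactor (Ideal.span {α}) 𝔟) : ℂ)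

end Objects

/-! ## The identity -/

section Identity

variable [IsTotallyReal K]

omit [NumberField K] [IsTotallyReal K] in
/-- Total positivity in `remb` coordinates. [folklore] -/
theorem remb_pos_of_isTotPos {x : K} (hx : NumberField.IsTotPos K x) (w : RP) : 0 < remb K x w := hx w

omit [NumberField K] [IsTotallyReal K] in
/-- Logarithmic coordinates of a product of totally positive elements. [folklore] -/
theorem logv_eq_of_mul_eq {a b c e : 𝓞 K} (h : a * b = c * e) (ha : NumberField.IsTotPos K (a : K))
    (hb : NumberField.IsTotPos K (b : K)) (hc : NumberField.IsTotPos K (c : K)) (he : NumberField.IsTotPos K (e : K)) (w : RP) :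
    logv K a w + logv K b w = logv K c w + logv K e w := by
  unfold logv
  have h' : remb K (a : K) w * remb K (b : K) w = remb K (c : K) w * remb K (e : K) w := by
    have := congrArg (fun x : 𝓞 K => remb K (x : K) w) h
    simpa [remb_mul] using this
  rw [← Real.log_mul (remb_pos_of_isTotPos ha w).ne' (remb_pos_of_isTotPos hb w).ne',
    ← Real.log_mul (remb_pos_of_isTotPos hc w).ne' (remb_pos_of_isTotPos he w).ne', h']

variable {𝔮 𝔭₁ 𝔭₂ : Ideal (𝓞 K)} {ρ₀ : 𝓞 K} (χ : AddChar (Additive ((𝓞 K ⧸ 𝔮)ˣ)) ℂ)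
  (k : ℝ → ℂ) (M U : ℝ) (Bl : Finset (Ideal (𝓞 K))) (gen : Ideal (𝓞 K) → 𝓞 K)
  (B A₂ : Finset (𝓞 K))

/-- **The reparametrisation identity** (Hinz, display before (4.20)): see the file docstring.
Hypotheses: `(ρ₀) = 𝔭₁𝔭₂`, `ρ₀ ≫ 0`, `ρ₀` prime to `𝔮`, `𝔭₁ ≠ 0`; for `𝔟 ∈ Bl`:
`gen 𝔟 ≫ 0` and `(gen 𝔟) = 𝔭₁𝔟`; `B` consists of totally positive elements and contains every
totally positive `α` with `Ω(α) ≠ 0`; `A₂` contains `ρ₀α/gen 𝔟` for all `𝔟 ∈ Bl`, `α ∈ B`,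
`𝔟 ∣ (α)` with `Ω(α) ≠ 0`. [cite: Hinz1988, §4 (4.11)–(4.19)] -/
theorem reparam [Fintype (𝓞 K ⧸ 𝔮)] (hρ : Ideal.span {ρ₀} = 𝔭₁ * 𝔭₂) (hρpos : NumberField.IsTotPos K (ρ₀ : K))
    (hρu : IsUnit (Ideal.Quotient.mk 𝔮 ρ₀)) (h𝔭₁ : 𝔭₁ ≠ ⊥)
    (hgen : ∀ 𝔟 ∈ Bl, NumberField.IsTotPos K (gen 𝔟 : K) ∧ Ideal.span {gen 𝔟} = 𝔭₁ * 𝔟)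
    (hBpos : ∀ α ∈ B, NumberField.IsTotPos K (α : K))
    (hBsupp : ∀ α : 𝓞 K, NumberField.IsTotPos K (α : K) → weightΩ K k M α ≠ 0 → α ∈ B)
    (hA₂ : ∀ 𝔟 ∈ Bl, ∀ α ∈ B, 𝔟 ∣ Ideal.span {α} → weightΩ K k M α ≠ 0 → quot ρ₀ (gen 𝔟) α ∈ A₂) :
    S4block K χ k M U Bl B = conj (unitValue χ (Ideal.Quotient.mk 𝔮 ρ₀)) *
      ∑ α₁ ∈ Bl.image gen, ∑ α₂ ∈ A₂,
        coeff₁ K 𝔭₁ α₁ * coeff₂ K 𝔭₂ U α₂ * crossΩ K k M ρ₀ α₁ α₂ *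
          unitValue χ (Ideal.Quotient.mk 𝔮 (α₁ * α₂)) := by
  have hρ0 : ρ₀ ≠ 0 := by
    intro h; have := hρpos (Classical.arbitrary RP); rw [h] at this; simp at this
  -- basic facts for `𝔟 ∈ Bl`
  have hgen0 : ∀ 𝔟 ∈ Bl, gen 𝔟 ≠ 0 := fun 𝔟 h𝔟 h0 => by
    have := (hgen 𝔟 h𝔟).1 (Classical.arbitrary RP); rw [h0] at this; simp at this
  have hBl0 : ∀ 𝔟 ∈ Bl, 𝔟 ≠ ⊥ := by
    intro 𝔟 h𝔟 h0
    have e : Ideal.span {gen 𝔟} = ⊥ := by rw [(hgen 𝔟 h𝔟).2, h0, Ideal.mul_bot]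
    exact hgen0 𝔟 h𝔟 (Ideal.span_singleton_eq_bot.1 e)
  have hgen_inj : ∀ 𝔟 ∈ Bl, ∀ 𝔟' ∈ Bl, gen 𝔟 = gen 𝔟' → 𝔟 = 𝔟' := by
    intro 𝔟 h𝔟 𝔟' h𝔟' h
    have e := (hgen 𝔟 h𝔟).2
    rw [h, (hgen 𝔟' h𝔟').2] at e
    exact (mul_left_cancel₀ h𝔭₁ e).symm
  have hcof₁ : ∀ 𝔟 ∈ Bl, cofactor (Ideal.span {gen 𝔟}) 𝔭₁ = 𝔟 := fun 𝔟 h𝔟 =>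
    cofactor_eq_of_mul_eq h𝔭₁ (hgen 𝔟 h𝔟).2.symm
  -- the unit value of `ρ₀` cancels
  have hconj : conj (unitValue χ (Ideal.Quotient.mk 𝔮 ρ₀)) * unitValue χ (Ideal.Quotient.mk 𝔮 ρ₀) = 1 :=
    conj_unitValue_mul_self χ hρu
  -- the index sets and the summands
  set s := Bl.sigma (fun 𝔟 => B.filter (fun α => 𝔟 ∣ Ideal.span {α} ∧ cofactor (Ideal.span {α}) 𝔟 ≠ ⊤))
    with hs
  set t := (Bl.image gen) ×ˢ A₂ with ht
  set f : (Σ _ : Ideal (𝓞 K), 𝓞 K) → ℂ := fun p => (idealVonMangoldt p.1 : ℂ) *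
    (weightΩ K k M p.2 * unitValue χ (Ideal.Quotient.mk 𝔮 p.2) * (eU K U (cofactor (Ideal.span {p.2}) p.1) : ℂ))
    with hf
  set g : 𝓞 K × 𝓞 K → ℂ := fun q => conj (unitValue χ (Ideal.Quotient.mk 𝔮 ρ₀)) *
    (coeff₁ K 𝔭₁ q.1 * coeff₂ K 𝔭₂ U q.2 * crossΩ K k M ρ₀ q.1 q.2 *
      unitValue χ (Ideal.Quotient.mk 𝔮 (q.1 * q.2))) with hg
  have hLHS : S4block K χ k M U Bl B = ∑ p ∈ s, f p := by
    rw [S4block, hs, Finset.sum_sigma]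
    refine Finset.sum_congr rfl fun 𝔟 _ => ?_
    rw [Finset.mul_sum]
  have hRHS : conj (unitValue χ (Ideal.Quotient.mk 𝔮 ρ₀)) *
      ∑ α₁ ∈ Bl.image gen, ∑ α₂ ∈ A₂, coeff₁ K 𝔭₁ α₁ * coeff₂ K 𝔭₂ U α₂ * crossΩ K k M ρ₀ α₁ α₂ *
        unitValue χ (Ideal.Quotient.mk 𝔮 (α₁ * α₂)) = ∑ q ∈ t, g q := by
    rw [ht, Finset.sum_product, Finset.mul_sum]
    refine Finset.sum_congr rfl fun α₁ _ => ?_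
    rw [Finset.mul_sum]
  rw [hLHS, hRHS]
  -- membership unpacking
  have hmem_s : ∀ p ∈ s, p.1 ∈ Bl ∧ p.2 ∈ B ∧ p.1 ∣ Ideal.span {p.2} ∧ cofactor (Ideal.span {p.2}) p.1 ≠ ⊤ := by
    intro p hp
    rw [hs, Finset.mem_sigma, Finset.mem_filter] at hp
    exact ⟨hp.1, hp.2.1, hp.2.2.1, hp.2.2.2⟩
  -- the key computation for a pair `(𝔟, α)`: with `α₁ = gen 𝔟`, `α₂ = quot`
  have key : ∀ p ∈ s, f p ≠ 0 →
      let α₁ := gen p.1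
      let α₂ := quot ρ₀ (gen p.1) p.2
      gen p.1 ∣ ρ₀ * p.2 ∧ α₁ * α₂ = ρ₀ * p.2 ∧ NumberField.IsTotPos K (α₂ : K) ∧
        Ideal.span {α₂} = 𝔭₂ * cofactor (Ideal.span {p.2}) p.1 ∧ (α₁, α₂) ∈ t ∧ f p = g (α₁, α₂) := by
    intro p hp hfp
    obtain ⟨h𝔟, hαB, hdvd, hcof⟩ := hmem_s p hp
    obtain ⟨hgpos, hgspan⟩ := hgen p.1 h𝔟
    have hgd : gen p.1 ∣ ρ₀ * p.2 := gen_dvd hρ hgspan hdvd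
    have hmul : gen p.1 * quot ρ₀ (gen p.1) p.2 = ρ₀ * p.2 := gen_mul_quot hgd
    have hαpos : NumberField.IsTotPos K (p.2 : K) := hBpos p.2 hαB
    have hq_pos : NumberField.IsTotPos K (quot ρ₀ (gen p.1) p.2 : K) := by
      refine isTotPos_of_mul_left (x := (gen p.1 : K)) ?_ hgpos
      have : ((gen p.1 : 𝓞 K) : K) * (quot ρ₀ (gen p.1) p.2 : K) = (ρ₀ : K) * (p.2 : K) := by
        exact_mod_cast congrArg (fun x : 𝓞 K => (x : K)) hmul
      rw [this]; exact hρpos.mul hαpos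
    have hWne : weightΩ K k M p.2 ≠ 0 := by
      intro h0; apply hfp; simp only [hf, h0, zero_mul, mul_zero]
    -- the ideal of `α₂`
    have hspan₂ : Ideal.span {quot ρ₀ (gen p.1) p.2} = 𝔭₂ * cofactor (Ideal.span {p.2}) p.1 := by
      have e1 : Ideal.span {gen p.1} * Ideal.span {quot ρ₀ (gen p.1) p.2} =
          Ideal.span {ρ₀} * Ideal.span {p.2} := by
        rw [Ideal.span_singleton_mul_span_singleton, Ideal.span_singleton_mul_span_singleton, hmul]
      rw [hgspan, hρ, ← mul_cofactor hdvd] at e1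
      have e2 : 𝔭₁ * p.1 * Ideal.span {quot ρ₀ (gen p.1) p.2} = 𝔭₁ * p.1 * (𝔭₂ * cofactor (Ideal.span {p.2}) p.1) := by
        rw [e1]; ring
      exact mul_left_cancel₀ (mul_ne_zero h𝔭₁ (hBl0 p.1 h𝔟)) e2
    have hmem_t : (gen p.1, quot ρ₀ (gen p.1) p.2) ∈ t := by
      rw [ht, Finset.mem_product]
      exact ⟨Finset.mem_image_of_mem _ h𝔟, hA₂ p.1 h𝔟 p.2 hαB hdvd hWne⟩
    refine ⟨hgd, hmul, hq_pos, hspan₂, hmem_t, ?_⟩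
    -- the values agree
    have hc₁ : coeff₁ K 𝔭₁ (gen p.1) = (idealVonMangoldt p.1 : ℂ) := by
      rw [coeff₁, hcof₁ p.1 h𝔟]
    have hdvd₂ : 𝔭₂ ∣ Ideal.span {quot ρ₀ (gen p.1) p.2} := ⟨_, hspan₂⟩
    have hcof₂ : cofactor (Ideal.span {quot ρ₀ (gen p.1) p.2}) 𝔭₂ = cofactor (Ideal.span {p.2}) p.1 := by
      have h𝔭₂ : 𝔭₂ ≠ ⊥ := by
        intro h; rw [h, Ideal.mul_bot] at hρ; exact hρ0 (Ideal.span_singleton_eq_bot.1 hρ)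
      exact cofactor_eq_of_mul_eq h𝔭₂ hspan₂.symm
    have hc₂ : coeff₂ K 𝔭₂ U (quot ρ₀ (gen p.1) p.2) = (eU K U (cofactor (Ideal.span {p.2}) p.1) : ℂ) := by
      rw [coeff₂, if_pos ⟨hq_pos, hdvd₂, by rw [hcof₂]; exact hcof⟩, hcof₂]
    have hcw : crossΩ K k M ρ₀ (gen p.1) (quot ρ₀ (gen p.1) p.2) = weightΩ K k M p.2 := by
      simp only [crossΩ, crossWeight, weightΩ]
      refine Finset.prod_congr rfl fun w _ => ?_
      have := logv_eq_of_mul_eq hmul hgpos hq_pos hρpos hαpos w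
      rw [show logv K (gen p.1) w + logv K (quot ρ₀ (gen p.1) p.2) w - (logv K ρ₀ w + Real.log M) =
        logv K p.2 w - Real.log M by linarith]
      rfl
    have hχ : conj (unitValue χ (Ideal.Quotient.mk 𝔮 ρ₀)) *
        unitValue χ (Ideal.Quotient.mk 𝔮 (gen p.1 * quot ρ₀ (gen p.1) p.2)) =
        unitValue χ (Ideal.Quotient.mk 𝔮 p.2) := by
      rw [hmul, map_mul, unitValue_mul, ← mul_assoc, hconj, one_mul]
    simp only [hf, hg, hc₁, hc₂, hcw]
    rw [← hχ]
    ring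
  refine Finset.sum_bij_ne_zero (fun p _ _ => (gen p.1, quot ρ₀ (gen p.1) p.2)) ?_ ?_ ?_ ?_
  · -- maps into `t`
    intro p hp hfp
    exact (key p hp hfp).2.2.2.2.1
  · -- injective
    intro p hp hfp p' hp' hfp' h
    simp only [Prod.mk.injEq] at h
    obtain ⟨h1, h2⟩ := h
    have hb : p.1 = p'.1 := hgen_inj p.1 (hmem_s p hp).1 p'.1 (hmem_s p' hp').1 h1
    have hm := (key p hp hfp).2.1
    have hm' := (key p' hp' hfp').2.1
    rw [h2, h1, hm'] at hm
    have hα : p.2 = p'.2 := (mul_left_cancel₀ hρ0 hm).symm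
    exact Sigma.ext hb (heq_of_eq hα)
  · -- surjective onto the support of `g`
    intro q hq hgq
    rw [ht, Finset.mem_product, Finset.mem_image] at hq
    obtain ⟨⟨𝔟, h𝔟, hq1⟩, hq2⟩ := hq
    -- unpack `g q ≠ 0`
    have hc₂ne : coeff₂ K 𝔭₂ U q.2 ≠ 0 := by
      intro h0; apply hgq; simp only [hg, h0, mul_zero, zero_mul]
    have hcond : NumberField.IsTotPos K (q.2 : K) ∧ 𝔭₂ ∣ Ideal.span {q.2} ∧ cofactor (Ideal.span {q.2}) 𝔭₂ ≠ ⊤ := by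
      by_contra h; exact hc₂ne (by rw [coeff₂, if_neg h])
    obtain ⟨hq2pos, hq2dvd, hq2cof⟩ := hcond
    have hcwne : crossΩ K k M ρ₀ q.1 q.2 ≠ 0 := by
      intro h0; apply hgq; simp only [hg, h0, mul_zero, zero_mul]
    obtain ⟨hgpos, hgspan⟩ := hgen 𝔟 h𝔟
    rw [hq1] at hgpos hgspan
    -- `α := q.1 q.2 / ρ₀`
    obtain ⟨α, hα⟩ := rho_dvd hρ hgspan hq2dvd
    have hαpos : NumberField.IsTotPos K (α : K) := by
      refine isTotPos_of_mul_left (x := (ρ₀ : K)) ?_ hρpos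
      have : ((ρ₀ : 𝓞 K) : K) * (α : K) = (q.1 : K) * (q.2 : K) := by
        exact_mod_cast congrArg (fun x : 𝓞 K => (x : K)) hα.symm
      rw [this]; exact hgpos.mul hq2pos
    -- `(α) = 𝔟 · (q.2)/𝔭₂`
    have h𝔭₂ : 𝔭₂ ≠ ⊥ := by
      intro h; rw [h, Ideal.mul_bot] at hρ; exact hρ0 (Ideal.span_singleton_eq_bot.1 hρ)
    have hspanα : Ideal.span {α} = 𝔟 * cofactor (Ideal.span {q.2}) 𝔭₂ := by
      have e1 : Ideal.span {ρ₀} * Ideal.span {α} = Ideal.span {q.1} * Ideal.span {q.2} := by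
        rw [Ideal.span_singleton_mul_span_singleton, Ideal.span_singleton_mul_span_singleton, hα]
      rw [hρ, hgspan, ← mul_cofactor hq2dvd] at e1
      have e2 : 𝔭₁ * 𝔭₂ * Ideal.span {α} = 𝔭₁ * 𝔭₂ * (𝔟 * cofactor (Ideal.span {q.2}) 𝔭₂) := by
        rw [e1]; ring
      exact mul_left_cancel₀ (mul_ne_zero h𝔭₁ h𝔭₂) e2
    have hdvdα : 𝔟 ∣ Ideal.span {α} := ⟨_, hspanα⟩
    have hcofα : cofactor (Ideal.span {α}) 𝔟 = cofactor (Ideal.span {q.2}) 𝔭₂ :=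
      cofactor_eq_of_mul_eq (hBl0 𝔟 h𝔟) hspanα.symm
    -- `Ω(α) = Ω×(q) ≠ 0`, so `α ∈ B`
    have hWα : weightΩ K k M α = crossΩ K k M ρ₀ q.1 q.2 := by
      simp only [crossΩ, crossWeight, weightΩ]
      refine Finset.prod_congr rfl fun w _ => ?_
      have := logv_eq_of_mul_eq hα hgpos hq2pos hρpos hαpos w
      rw [show logv K q.1 w + logv K q.2 w - (logv K ρ₀ w + Real.log M) = logv K α w - Real.log M by linarith]
      rfl
    have hαB : α ∈ B := hBsupp α hαpos (by rw [hWα]; exact hcwne)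
    have hp_s : (⟨𝔟, α⟩ : Σ _ : Ideal (𝓞 K), 𝓞 K) ∈ s := by
      rw [hs, Finset.mem_sigma, Finset.mem_filter]
      exact ⟨h𝔟, hαB, hdvdα, by rw [hcofα]; exact hq2cof⟩
    -- the quotient is `q.2`
    have hgd : gen 𝔟 ∣ ρ₀ * α := by
      rw [hq1]; exact ⟨q.2, hα.symm⟩
    have hquot : quot ρ₀ (gen 𝔟) α = q.2 := by
      have h1 := gen_mul_quot hgd
      have h2 : gen 𝔟 * q.2 = ρ₀ * α := by rw [hq1]; exact hα
      exact mul_left_cancel₀ (hgen0 𝔟 h𝔟) (h1.trans h2.symm)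
    have hfval : f ⟨𝔟, α⟩ = g q := by
      -- `f p = g (gen 𝔟, quot) = g q` once we know `f p ≠ 0`-independent value identity;
      -- we recompute it through `key` applied formally: `key` needs `f p ≠ 0`, so argue directly
      have hval : f ⟨𝔟, α⟩ = g (gen 𝔟, quot ρ₀ (gen 𝔟) α) := by
        by_cases hf0 : f ⟨𝔟, α⟩ = 0
        · -- then `g q = 0` too, contradiction with `hgq`; so this case is vacuous
          exfalso
          apply hgq
          -- expand `g q` and use `Ω(α) ≠ 0`? Instead: `f = Λ·Ω·χ·e`; show each factor of `g q` appears
          have hfexp : f ⟨𝔟, α⟩ = (idealVonMangoldt 𝔟 : ℂ) * (weightΩ K k M α * unitValue χ (Ideal.Quotient.mk 𝔮 α) *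
              (eU K U (cofactor (Ideal.span {α}) 𝔟) : ℂ)) := rfl
          have hgexp : g q = conj (unitValue χ (Ideal.Quotient.mk 𝔮 ρ₀)) *
              (coeff₁ K 𝔭₁ q.1 * coeff₂ K 𝔭₂ U q.2 * crossΩ K k M ρ₀ q.1 q.2 *
                unitValue χ (Ideal.Quotient.mk 𝔮 (q.1 * q.2))) := rfl
          have hc₁ : coeff₁ K 𝔭₁ q.1 = (idealVonMangoldt 𝔟 : ℂ) := by rw [coeff₁, ← hq1, hcof₁ 𝔟 h𝔟]
          have hc₂ : coeff₂ K 𝔭₂ U q.2 = (eU K U (cofactor (Ideal.span {α}) 𝔟) : ℂ) := by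
            rw [coeff₂, if_pos ⟨hq2pos, hq2dvd, hq2cof⟩, hcofα]
          have hχ : conj (unitValue χ (Ideal.Quotient.mk 𝔮 ρ₀)) * unitValue χ (Ideal.Quotient.mk 𝔮 (q.1 * q.2)) =
              unitValue χ (Ideal.Quotient.mk 𝔮 α) := by
            rw [hα, map_mul, unitValue_mul, ← mul_assoc, hconj, one_mul]
          rw [hgexp, hc₁, hc₂, ← hWα]
          calc conj (unitValue χ (Ideal.Quotient.mk 𝔮 ρ₀)) * ((idealVonMangoldt 𝔟 : ℂ) *
                (eU K U (cofactor (Ideal.span {α}) 𝔟) : ℂ) * weightΩ K k M α * unitValue χ (Ideal.Quotient.mk 𝔮 (q.1 * q.2)))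
              = (idealVonMangoldt 𝔟 : ℂ) * (weightΩ K k M α *
                  (conj (unitValue χ (Ideal.Quotient.mk 𝔮 ρ₀)) * unitValue χ (Ideal.Quotient.mk 𝔮 (q.1 * q.2))) *
                  (eU K U (cofactor (Ideal.span {α}) 𝔟) : ℂ)) := by ring
            _ = f ⟨𝔟, α⟩ := by rw [hχ, hfexp]
            _ = 0 := hf0
        · exact (key ⟨𝔟, α⟩ hp_s hf0).2.2.2.2.2
      rw [hval, hquot, hq1]
    refine ⟨⟨𝔟, α⟩, hp_s, ?_, ?_⟩
    · rw [hfval]; exact hgq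
    · show (gen 𝔟, quot ρ₀ (gen 𝔟) α) = q
      rw [hquot, hq1]
  · -- values
    intro p hp hfp
    exact (key p hp hfp).2.2.2.2.2

/-- `|S₄-block(χ)| = |∑∑ c₁ c₂ Ω× χ(α₁α₂)|` under the hypotheses of `reparam`. [folklore] -/
theorem norm_S4block_eq [Fintype (𝓞 K ⧸ 𝔮)] (hρ : Ideal.span {ρ₀} = 𝔭₁ * 𝔭₂) (hρpos : NumberField.IsTotPos K (ρ₀ : K))
    (hρu : IsUnit (Ideal.Quotient.mk 𝔮 ρ₀)) (h𝔭₁ : 𝔭₁ ≠ ⊥)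
    (hgen : ∀ 𝔟 ∈ Bl, NumberField.IsTotPos K (gen 𝔟 : K) ∧ Ideal.span {gen 𝔟} = 𝔭₁ * 𝔟)
    (hBpos : ∀ α ∈ B, NumberField.IsTotPos K (α : K))
    (hBsupp : ∀ α : 𝓞 K, NumberField.IsTotPos K (α : K) → weightΩ K k M α ≠ 0 → α ∈ B)
    (hA₂ : ∀ 𝔟 ∈ Bl, ∀ α ∈ B, 𝔟 ∣ Ideal.span {α} → weightΩ K k M α ≠ 0 → quot ρ₀ (gen 𝔟) α ∈ A₂) :
    ‖S4block K χ k M U Bl B‖ = ‖∑ α₁ ∈ Bl.image gen, ∑ α₂ ∈ A₂,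
        coeff₁ K 𝔭₁ α₁ * coeff₂ K 𝔭₂ U α₂ * crossΩ K k M ρ₀ α₁ α₂ *
          unitValue χ (Ideal.Quotient.mk 𝔮 (α₁ * α₂))‖ := by
  rw [reparam χ k M U Bl gen B A₂ hρ hρpos hρu h𝔭₁ hgen hBpos hBsupp hA₂, norm_mul,
    Complex.norm_conj, norm_unitValue_of_isUnit χ hρu, one_mul]

end Identity

end Literature.NumberTheory.Sieve.TypeTwoReparam
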